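import Mathlib
import Summits.Ventures.PercRepro2.SevenKernel
import Summits.Ventures.PercRepro2.SevenConn
import Summits.Ventures.PercRepro2.SevenTables
import Summits.Ventures.PercRepro2.SevenTyped
import Summits.Ventures.PercRepro2.SevenCerts1
import Summits.Ventures.PercRepro2.SevenCerts2
import Summits.Ventures.PercRepro2.SevenCerts3
import Summits.Ventures.PercRepro2.SevenCerts4
import Summits.Ventures.PercRepro2.SevenCerts5
import Summits.Ventures.PercRepro2.BlockSubstConn
import Summits.Ventures.PercRepro2.BlockSubstLaw

/-!
# THEOREM 33 — (HCOV) AND ROW 2′TRI ON THE TWO-HUB FAMILY: THE FIRST SEVEN-TERMINAL THEOREMS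
(blind cell PercRepro2, mine-2 g34)

**The family.** Seven vertices: the five marks `o = 0, a₁ = 1, a₂ = 2, a₃ = 3, b = 4` and two unmarked hubs `u = 5`,
`w = 6`; `hub x y` (`x < y` in `Fin 5`) is the skeleton in which both hubs are joined to every mark, the hubs are
adjacent, and the marks span the single edge `x y`.  A graph in which the two unmarked vertices are joined to any of
the marks and (possibly) to each other, while the marks span AT MOST ONE edge, is one of the ten skeletons with some
edges at weight `0` — so THEOREM 33 covers every such graph for every weight vector.  These are genuinely
seven-terminal instances (both hubs of degree up to `6`): outside every six-terminal class of the cell (Theorem 32),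
inside typer-1 g52's weighted residual `WReducedB` when both hubs have degree `≥ 3` — the first (HCOV) theorems of the
cell on a seven-terminal family.

**The proof.** The ten kernel certificates `cert_hub01 … cert_hub34` (`SevenCerts1–5.lean`, one `decide +kernel`
each) and the generic bridge `SevenTyped.HCov_seven` / `SevenTyped.typedBases`: `cert_all`, `typedBases_hub`,
`HCov_hub`.  **`HCov_of_hub`** lifts each skeleton to every block substitution of it (`BlockSubst.HCov_of_skeleton`,
mine-2 g33): every graph with at most seven terminals whose mark-free two-terminal blocks sit on one of the ten
skeletons, every weight vector, `n` arbitrary.  Own work; standard axioms.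
-/

namespace Summit.Ventures.PercRepro2

namespace Seven

/-- **The two-hub skeleton with the mark–mark edge `x y`**: `u = 5` and `w = 6` joined to every mark (edges `0..4` at
`u`, `5..9` at `w`), the hubs adjacent (edge `10`), and the mark–mark edge `x y` (edge `11`). -/
def hub (x y : Fin 5) : Fin 12 → Fin 7 × Fin 7 :=
  ![(0, 5), (1, 5), (2, 5), (3, 5), (4, 5), (0, 6), (1, 6), (2, 6), (3, 6), (4, 6), (5, 6),
    (Fin.castLE (by norm_num) x, Fin.castLE (by norm_num) y)]

/-- **Every pair has its certificate**: `Cert (hub x y)` for all `x < y` in `Fin 5`. -/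
theorem cert_all (x y : Fin 5) (hxy : x < y) : Cert (hub x y) := by
  fin_cases x <;> fin_cases y
  · exact absurd hxy (by decide)
  · exact cert_hub01
  · exact cert_hub02
  · exact cert_hub03
  · exact cert_hub04
  · exact absurd hxy (by decide)
  · exact absurd hxy (by decide)
  · exact cert_hub12
  · exact cert_hub13
  · exact cert_hub14
  · exact absurd hxy (by decide)
  · exact absurd hxy (by decide)
  · exact absurd hxy (by decide)
  · exact cert_hub23
  · exact cert_hub24
  · exact absurd hxy (by decide)
  · exact absurd hxy (by decide)
  · exact absurd hxy (by decide)
  · exact absurd hxy (by decide)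
  · exact cert_hub34
  · exact absurd hxy (by decide)
  · exact absurd hxy (by decide)
  · exact absurd hxy (by decide)
  · exact absurd hxy (by decide)
  · exact absurd hxy (by decide)

section Theorem

variable {R : Type*} [Field R] [LinearOrder R] [IsStrictOrderedRing R]

/-- **THEOREM 33 (typed form): row 2′TRI on every two-hub skeleton `hub x y`, `x < y`** —
`CovForm.TypedBases (ends (hub x y)) 0 1 2 3 4`. -/
theorem typedBases_hub (x y : Fin 5) (hxy : x < y) :
    CovForm.TypedBases (R := R) (ends (hub x y)) 0 1 2 3 4 :=
  typedBases (hub x y) (cert_all x y hxy)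

/-- **THEOREM 33: (HCOV) on every two-hub skeleton `hub x y`, `x < y`, for every weight vector** — every
seven-vertex graph whose two unmarked vertices are joined to any of the five marks and to each other while the marks
span at most the one edge `x y`, the twelve edges at any weights (missing edges at weight `0`). -/
theorem HCov_hub (x y : Fin 5) (hxy : x < y) (p : Fin 12 → R) (hp : IsProbVec p) :
    CovForm.HCov p (ends (hub x y)) 0 1 2 3 4 :=
  HCov_seven (hub x y) (cert_all x y hxy) p hp

/-- **THEOREM 33 lifted by block substitution**: (HCOV) on every graph whose edges fall into mark-free
two-terminal blocks on a two-hub skeleton `hub x y` (`x < y`) along an injective terminal map `q : Fin 7 → V` — the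
marks `q 0, q 1, q 2, q 3, q 4`, the two unmarked terminals `q 5`, `q 6`; `n` arbitrary, every weight vector. -/
theorem HCov_of_hub {V E : Type*} [Fintype E] [DecidableEq E] [DecidableEq V] {ends : E → Sym2 V}
    {q : Fin 7 → V} {blk : E → Fin 12} {Vj : Fin 12 → Set V} {x y : Fin 5} (hxy : x < y)
    (hB : BlockSubst.IsBlockSubst ends (Seven.ends (hub x y)) q blk Vj) (p : E → R) (hp : IsProbVec p) :
    CovForm.HCov p ends (q 0) (q 1) (q 2) (q 3) (q 4) :=
  BlockSubst.HCov_of_skeleton hB 0 1 2 3 4 (fun r hr => HCov_hub x y hxy r hr) p hp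

end Theorem

end Seven

end Summit.Ventures.PercRepro2
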